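import Mathlib.Analysis.InnerProductSpace.Adjoint
import Mathlib.Analysis.InnerProductSpace.Projection.FiniteDimensional
import HarnessLib

/-!
# Weil's family of abelian varieties of Weil type, I: the invariant alternating forms

B. van Geemen, *An introduction to the Hodge conjecture for abelian varieties*, LNM 1594 (1994),
§5.3–5.6 constructs the `n²`-dimensional family of `2n`-dimensional polarized abelian varieties of
Weil type: `V = K^{2n}`, `K = ℚ(√-d)`, a `K`-Hermitian form `H` of signature `(n, n)`,
`V_ℝ = K^{2n} ⊗ ℝ = ℂ^{2n}`, a complex subspace `V₊ ⊂ V_ℝ` of dimension `n` with `H|V₊ > 0`,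
`V₋ = V₊^⊥`, the complex structure `J = i` on `V₊`, `-i` on `V₋`, and the Riemann form `E = Im H`
(5.5); Theorem 6.12 (with 6.11) then shows that for a GENERAL member `B¹ = NS_ℚ = ℚ · E`
("`B¹(X) = ℚ`", the first half of Thm. 4.11 = Weil 1977), the invariant-theoretic input being that
the `SU_H = SL_{2n}(ℂ)`-invariants in `⋀²(W ⊕ W^*)` form a line (proof of Thm. 6.12, case `p = 1`,
which is where `n > 1` is needed).

This file is the LINEAR-ALGEBRA core of that statement, in the infinitesimal form in which the
files `WeilFamilyComplexStructures` / `WeilFamilyPicardRankOne` use it. On `U = P × P` (`P` a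
finite-dimensional complex inner product space of dimension `n`, so `U = ℂⁿ ⊕ ℂⁿ` carries the
Hermitian form `hermForm x y = ⟪x₁, y₁⟫ - ⟪x₂, y₂⟫` of signature `(n, n)` and the Riemann form
`riemannForm = Im hermForm`), the tangent space at the base point `V₊ = P ⊕ 0` of the family is the
subspace `𝔭 = {T_B : B ∈ End_ℂ P}`, `T_B (x₁, x₂) = (B† x₂, B x₁)`, of the Lie algebra
`𝔲(hermForm) ≅ 𝔲(n, n)` (`offDiag B`; `hermForm_offDiag`: each `T_B` is skew for `hermForm`). The main
theorem `exists_eq_smul_riemannForm_of_forall_offDiag`: for `n ≥ 2`, a real-bilinear ALTERNATING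
form `E'` on `U` which is infinitesimally invariant under all of `𝔭`,
`E' (T_B x) y + E' x (T_B y) = 0`, is a real multiple of `riemannForm`. (Over `ℂ`, `𝔭` spans all
block-off-diagonal endomorphisms of `ℂⁿ ⊕ ℂⁿ = W`, and the statement is the computation
`(⋀² W^*_ℝ ⊗ ℂ)^{𝔭_ℂ} = ℂ · H`, i.e. van Geemen's "`dim (⋀²(W ⊕ W^*))^{SL_{2n}} = 1`" for `p = 1`;
for `n = 1` it fails: `⋀² W` is then invariant.) The proof is elementary, by testing the
hypothesis on rank-one operators `B = |w⟩⟨v|` (`rankOne`): the mixed block of `E'` vanishes because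
every `u ∈ P` has a non-zero vector orthogonal to it (`n ≥ 2`), and the two diagonal blocks are
forced to be `∓ c · Im ⟪·, ·⟫` with the same constant `c`.

## Main statements

* `hermForm`, `riemannForm`, `offDiag`, `rankOne`; `riemannForm_swap` (alternating),
  `hermForm_offDiag` / `riemannForm_offDiag` (`𝔭 ⊆ 𝔲(H)`), `adjoint_rankOne_apply`.
* `exists_eq_smul_riemannForm_of_forall_offDiag` (van Geemen Thm. 6.12, `p = 1`, infinitesimal form).

## References

* B. van Geemen, in LNM 1594 (1994), §5.3–5.6, Thm. 6.12 (proof, case `p = 1`), Thm. 4.11.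
  [vanGeemen1994HodgeAV]
* A. Weil, *Abelian varieties and the Hodge ring*, Œuvres III (1977), 421–429. [Weil1977HodgeRing]
-/

noncomputable section

open Complex Module
open scoped InnerProductSpace ComplexConjugate

namespace Literature.AlgebraicGeometry.HodgeTheory

namespace WeilFamily

variable {P : Type*} [NormedAddCommGroup P] [InnerProductSpace ℂ P]

/-! ### The Hermitian form of signature `(n, n)` and its imaginary part -/

/-- The Hermitian form `H((x₁,x₂),(y₁,y₂)) = ⟪x₁, y₁⟫ - ⟪x₂, y₂⟫` of signature `(n, n)` on
`U = P × P = ℂⁿ ⊕ ℂⁿ` (conjugate-linear in the first variable, Mathlib's convention), van Geemen's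
`H` on `V_ℝ = K^{2n} ⊗ ℝ` in a basis adapted to `V₊ ⊕ V₋`. [cite: vanGeemen1994HodgeAV, §5.3–5.4] -/
def hermForm (x y : P × P) : ℂ := ⟪x.1, y.1⟫_ℂ - ⟪x.2, y.2⟫_ℂ

/-- The Riemann form `E = Im H` of the family (van Geemen 5.5: "`E := Im H` satisfies the Riemann
relations"). [cite: vanGeemen1994HodgeAV, §5.5] -/
def riemannForm (x y : P × P) : ℝ := (hermForm x y).im

/-- Unfolding of `hermForm`. [cite: vanGeemen1994HodgeAV, §5.3] -/
theorem hermForm_apply (x y : P × P) : hermForm x y = ⟪x.1, y.1⟫_ℂ - ⟪x.2, y.2⟫_ℂ := rfl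

/-- `E((x₁,x₂),(y₁,y₂)) = Im ⟪x₁, y₁⟫ - Im ⟪x₂, y₂⟫`. [cite: vanGeemen1994HodgeAV, §5.5] -/
theorem riemannForm_apply (x y : P × P) :
    riemannForm x y = (⟪x.1, y.1⟫_ℂ).im - (⟪x.2, y.2⟫_ℂ).im := by
  simp [riemannForm, hermForm]

/-- `H` is Hermitian: `H(y, x) = conj H(x, y)`. [cite: vanGeemen1994HodgeAV, §5.3] -/
theorem hermForm_swap (x y : P × P) : hermForm y x = conj (hermForm x y) := by
  simp [hermForm, map_sub, inner_conj_symm]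

/-- `E = Im H` is alternating: `E(y, x) = -E(x, y)`. [cite: vanGeemen1994HodgeAV, §5.5] -/
theorem riemannForm_swap (x y : P × P) : riemannForm y x = -riemannForm x y := by
  rw [riemannForm, hermForm_swap, Complex.conj_im]
  rfl

/-- `E(x, x) = 0`. [cite: vanGeemen1994HodgeAV, §5.5] -/
theorem riemannForm_self (x : P × P) : riemannForm x x = 0 := by
  have h := riemannForm_swap x x
  linarith

/-- `H` is additive in the first variable. [folklore] -/
theorem hermForm_add_left (x x' y : P × P) : hermForm (x + x') y = hermForm x y + hermForm x' y := by
  simp only [hermForm, Prod.fst_add, Prod.snd_add, inner_add_left]; ring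

/-- `H` is additive in the second variable. [folklore] -/
theorem hermForm_add_right (x y y' : P × P) : hermForm x (y + y') = hermForm x y + hermForm x y' := by
  simp only [hermForm, Prod.fst_add, Prod.snd_add, inner_add_right]; ring

/-- `H` is conjugate-linear in the first variable. [folklore] -/
theorem hermForm_smul_left (c : ℂ) (x y : P × P) : hermForm (c • x) y = conj c * hermForm x y := by
  simp only [hermForm, Prod.smul_fst, Prod.smul_snd, inner_smul_left]; ring

/-- `H` is linear in the second variable. [folklore] -/
theorem hermForm_smul_right (c : ℂ) (x y : P × P) : hermForm x (c • y) = c * hermForm x y := by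
  simp only [hermForm, Prod.smul_fst, Prod.smul_snd, inner_smul_right]; ring

/-! ### The tangent space `𝔭` of the family: block-off-diagonal skew-Hermitian operators -/

section OffDiag

variable [FiniteDimensional ℂ P]

/-- The operator `T_B (x₁, x₂) = (B† x₂, B x₁)` on `U = P × P`, for `B ∈ End_ℂ(P)`: these form the
subspace `𝔭 ≅ M_n(ℂ)` (real dimension `2n²`) of the Lie algebra `𝔲(H) ≅ 𝔲(n, n)` complementary to
`𝔲(n) × 𝔲(n)`, i.e. the tangent space `T ≅ SU(n,n)/S(U(n)×U(n))` of van Geemen's family `H_n` at its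
base point (5.6, 6.11). [cite: vanGeemen1994HodgeAV, §5.6 and Thm. 6.11 (proof)] -/
def offDiag (B : P →ₗ[ℂ] P) (x : P × P) : P × P := (LinearMap.adjoint B x.2, B x.1)

/-- First component of `T_B x`. [folklore] -/
@[simp] theorem offDiag_fst (B : P →ₗ[ℂ] P) (x : P × P) : (offDiag B x).1 = LinearMap.adjoint B x.2 := rfl

/-- Second component of `T_B x`. [folklore] -/
@[simp] theorem offDiag_snd (B : P →ₗ[ℂ] P) (x : P × P) : (offDiag B x).2 = B x.1 := rfl

/-- Each `T_B` is skew for `H`: `H(T_B x, y) + H(x, T_B y) = 0`, i.e. `𝔭 ⊆ 𝔲(H)`.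
[cite: vanGeemen1994HodgeAV, Thm. 6.11 (proof)] -/
theorem hermForm_offDiag (B : P →ₗ[ℂ] P) (x y : P × P) :
    hermForm (offDiag B x) y + hermForm x (offDiag B y) = 0 := by
  simp only [hermForm, offDiag_fst, offDiag_snd, LinearMap.adjoint_inner_left,
    LinearMap.adjoint_inner_right]
  ring

/-- Consequently the Riemann form `E = Im H` is infinitesimally invariant under `𝔭`.
[cite: vanGeemen1994HodgeAV, Thm. 6.11 (proof)] -/
theorem riemannForm_offDiag (B : P →ₗ[ℂ] P) (x y : P × P) :
    riemannForm (offDiag B x) y + riemannForm x (offDiag B y) = 0 := by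
  have h := congrArg Complex.im (hermForm_offDiag B x y)
  simpa [riemannForm] using h

/-- The rank-one operator `|w⟩⟨v| : x ↦ ⟪v, x⟫ w`. [folklore] -/
def rankOne (w v : P) : P →ₗ[ℂ] P := (innerₛₗ ℂ v).smulRight w

omit [FiniteDimensional ℂ P] in
/-- `|w⟩⟨v| x = ⟪v, x⟫ w`. [folklore] -/
@[simp] theorem rankOne_apply (w v x : P) : rankOne w v x = ⟪v, x⟫_ℂ • w := rfl

/-- `(|w⟩⟨v|)† = |v⟩⟨w|`: `(|w⟩⟨v|)† y = ⟪w, y⟫ v`. [folklore] -/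
theorem adjoint_rankOne_apply (w v y : P) : LinearMap.adjoint (rankOne w v) y = ⟪w, y⟫_ℂ • v := by
  apply ext_inner_right ℂ
  intro x
  rw [LinearMap.adjoint_inner_left, rankOne_apply, inner_smul_right, inner_smul_left,
    inner_conj_symm, mul_comm]

end OffDiag

/-! ### The invariant-theory step of Theorem 6.12 (`p = 1`) -/

section Invariant

variable [FiniteDimensional ℂ P]

/-- In a complex inner product space of dimension `≥ 2` every vector has a non-zero vector
orthogonal to it. [folklore] -/
theorem exists_ne_zero_inner_eq_zero (h2 : 2 ≤ finrank ℂ P) (u : P) :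
    ∃ v : P, v ≠ 0 ∧ ⟪u, v⟫_ℂ = 0 := by
  have hK : (ℂ ∙ u)ᗮ ≠ ⊥ := by
    intro hbot
    have h1 : finrank ℂ (ℂ ∙ u) ≤ 1 := by
      simpa using finrank_span_le_card ({u} : Set P)
    have h := Submodule.finrank_add_finrank_orthogonal (ℂ ∙ u)
    rw [hbot, finrank_bot] at h
    omega
  obtain ⟨v, hv, hv0⟩ := Submodule.exists_mem_ne_zero_of_ne_bot hK
  exact ⟨v, hv0, (Submodule.mem_orthogonal_singleton_iff_inner_right).1 hv⟩

variable (E' : (P × P) →ₗ[ℝ] (P × P) →ₗ[ℝ] ℝ)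

omit [FiniteDimensional ℂ P] in
/-- Real bilinearity against a complex scalar: `E' x (c • y) = Re c · E' x y + Im c · E' x (i y)`.
[folklore] -/
theorem apply_smul_right (x y : P × P) (c : ℂ) :
    E' x (c • y) = c.re * E' x y + c.im * E' x (I • y) := by
  have hc : c • y = (c.re : ℝ) • y + (c.im : ℝ) • (I • y) := by
    conv_lhs => rw [← Complex.re_add_im c]
    rw [add_smul, mul_smul, Complex.coe_smul, Complex.coe_smul]
  rw [hc, map_add, map_smul, map_smul, smul_eq_mul, smul_eq_mul]

omit [FiniteDimensional ℂ P] in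
/-- Real bilinearity against a complex scalar in the first variable. [folklore] -/
theorem apply_smul_left (x y : P × P) (c : ℂ) :
    E' (c • x) y = c.re * E' x y + c.im * E' (I • x) y := by
  have hc : c • x = (c.re : ℝ) • x + (c.im : ℝ) • (I • x) := by
    conv_lhs => rw [← Complex.re_add_im c]
    rw [add_smul, mul_smul, Complex.coe_smul, Complex.coe_smul]
  rw [hc, LinearMap.map_add₂, LinearMap.map_smul₂, LinearMap.map_smul₂, smul_eq_mul, smul_eq_mul]

omit [FiniteDimensional ℂ P] in
/-- `Im ⟪v, v⟫ = 0` and `Re ⟪v, v⟫ = ‖v‖²`, in `Complex` spelling. [folklore] -/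
theorem inner_self_im_re (v : P) : (⟪v, v⟫_ℂ).im = 0 ∧ (⟪v, v⟫_ℂ).re = ‖v‖ ^ 2 :=
  ⟨by simpa using inner_self_im (𝕜 := ℂ) v, by simpa using inner_self_eq_norm_sq (𝕜 := ℂ) v⟩

/-- **van Geemen, Thm. 6.12 for `p = 1` (Weil): the `𝔭`-invariant alternating forms are the
multiples of the Riemann form.** Let `dim_ℂ P ≥ 2` and let `E'` be a real-bilinear alternating form
on `U = P × P` such that `E' (T_B x) y + E' x (T_B y) = 0` for every `B ∈ End_ℂ(P)`
(`T_B = offDiag B`, the tangent space `𝔭` of the family of complex structures of Weil type). Then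
`E' = c · E` for a real constant `c`, `E = riemannForm = Im H`. This is the case `p = 1` of the
dimension count `dim Bᵖ(X) = dim [⋀^{2p}(W ⊕ W^*)]^{SL_{2n}(ℂ)} = 1 (p ≠ n)` in the proof of
Thm. 6.12 (the `ℂ`-span of `𝔭` is the space of block-off-diagonal endomorphisms of `W = ℂⁿ ⊕ ℂⁿ`,
under which `⋀² W^*` has the single invariant line `ℂ · H` once `n ≥ 2`), feeding "`B¹(X) = ℚ`"
of Thm. 4.11. Proof: write `E'` in blocks `α, β, δ` w.r.t. `P ⊕ P`; the hypothesis on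
`x = (u,0), y = (v,0)` gives `β(u, Bv) = β(v, Bu)`, on `x = (u,0), y = (0,w)` gives
`δ(Bu, w) + α(u, B†w) = 0`; with rank-one `B = |w⟩⟨v|`, `v ⊥ u`, `v ≠ 0` the first forces `β = 0`,
and the second with `u = v` forces `δ(w', w) = c · Im⟪w', w⟫`, then `α(u, w) = -c · Im⟪u, w⟫`.
[cite: vanGeemen1994HodgeAV, Thm. 6.12 (proof, `p = 1`) and Thm. 4.11] [cite: Weil1977HodgeRing] -/
theorem exists_eq_smul_riemannForm_of_forall_offDiag (h2 : 2 ≤ finrank ℂ P)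
    (halt : ∀ x, E' x x = 0)
    (hinv : ∀ (B : P →ₗ[ℂ] P) (x y : P × P), E' (offDiag B x) y + E' x (offDiag B y) = 0) :
    ∃ c : ℝ, ∀ x y, E' x y = c * riemannForm x y := by
  -- skew-symmetry from `halt`
  have hskew : ∀ x y, E' y x = -E' x y := by
    intro x y
    have h := halt (x + y)
    simp only [map_add, LinearMap.add_apply, halt x, halt y] at h
    linarith
  -- Prod bookkeeping
  have mk0 : ((0 : P), (0 : P)) = (0 : P × P) := rfl
  have smul0w : ∀ (c : ℂ) (w : P), ((0 : P), c • w) = c • ((0 : P), w) := fun c w ↦ by simp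
  have smulw0 : ∀ (c : ℂ) (w : P), (c • w, (0 : P)) = c • (w, (0 : P)) := fun c w ↦ by simp
  -- the three blocks
  set α : P → P → ℝ := fun u v ↦ E' (u, 0) (v, 0) with hα
  set β : P → P → ℝ := fun u w ↦ E' (u, 0) (0, w) with hβ
  set δ : P → P → ℝ := fun u w ↦ E' (0, u) (0, w) with hδ
  -- (*)  β(u, Bv) = β(v, Bu)
  have hstar : ∀ (B : P →ₗ[ℂ] P) (u v : P), β u (B v) = β v (B u) := by
    intro B u v
    have h := hinv B (u, 0) (v, 0)
    simp only [offDiag, map_zero] at h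
    have h' : E' (0, B u) (v, 0) = -β v (B u) := hskew _ _
    rw [h'] at h
    simp only [hβ]
    linarith
  -- (***)  δ(Bu, w) + α(u, B†w) = 0
  have h3 : ∀ (B : P →ₗ[ℂ] P) (u w : P), δ (B u) w + α u (LinearMap.adjoint B w) = 0 := by
    intro B u w
    have h := hinv B (u, 0) (0, w)
    simp only [offDiag, map_zero] at h
    simpa [hδ, hα] using h
  -- β = 0  (uses `n ≥ 2`)
  have hβ0 : ∀ u w, β u w = 0 := by
    intro u w
    obtain ⟨v, hv0, huv⟩ := exists_ne_zero_inner_eq_zero h2 u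
    have hvu : ⟪v, u⟫_ℂ = 0 := inner_eq_zero_symm.1 huv
    have h := hstar (rankOne w v) u v
    simp only [rankOne_apply, hvu, zero_smul, hβ, mk0, map_zero] at h
    rw [smul0w, apply_smul_right, (inner_self_im_re v).1, (inner_self_im_re v).2, zero_mul,
      add_zero] at h
    exact (mul_eq_zero.1 h).resolve_left (pow_ne_zero 2 (norm_ne_zero_iff.2 hv0))
  -- a non-zero vector and the constant
  obtain ⟨v₀, hv₀, -⟩ := exists_ne_zero_inner_eq_zero h2 0
  have hv₀' : (‖v₀‖ ^ 2 : ℝ) ≠ 0 := pow_ne_zero 2 (norm_ne_zero_iff.2 hv₀)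
  set c : ℝ := -α v₀ (I • v₀) / ‖v₀‖ ^ 2 with hc
  -- δ(w', w) = c · Im ⟪w', w⟫
  have hδc : ∀ w' w, δ w' w = c * (⟪w', w⟫_ℂ).im := by
    intro w' w
    have h := h3 (rankOne w' v₀) v₀ w
    rw [adjoint_rankOne_apply, rankOne_apply] at h
    simp only [hδ, hα] at h
    rw [smul0w, apply_smul_left, (inner_self_im_re v₀).1, (inner_self_im_re v₀).2, zero_mul,
      add_zero, smulw0, apply_smul_right, halt, mul_zero, zero_add, Prod.smul_mk, smul_zero] at h
    rw [hc]
    field_simp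
    simp only [hδ, hα]
    linarith
  -- α(u, w) = -c · Im ⟪u, w⟫
  have hαc : ∀ u w, α u w = -(c * (⟪u, w⟫_ℂ).im) := by
    intro u w
    have h := h3 (rankOne v₀ w) u v₀
    rw [adjoint_rankOne_apply, rankOne_apply, hδc, inner_smul_left, inner_conj_symm,
      Complex.mul_im, (inner_self_im_re v₀).1, (inner_self_im_re v₀).2, mul_zero, zero_add] at h
    simp only [hα] at h
    rw [smulw0, apply_smul_right, (inner_self_im_re v₀).1, (inner_self_im_re v₀).2, zero_mul,
      add_zero] at h
    have h' : ‖v₀‖ ^ 2 * (α u w + c * (⟪u, w⟫_ℂ).im) = 0 := by simp only [hα]; linarith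
    have := (mul_eq_zero.1 h').resolve_left hv₀'
    linarith
  -- assemble
  refine ⟨-c, fun x y ↦ ?_⟩
  have hx : x = ((x.1, (0 : P)) : P × P) + ((0 : P), x.2) := by simp
  have hy : y = ((y.1, (0 : P)) : P × P) + ((0 : P), y.2) := by simp
  rw [hx, hy]
  simp only [map_add, LinearMap.add_apply]
  have e1 : E' (x.1, 0) (y.1, 0) = α x.1 y.1 := rfl
  have e2 : E' (x.1, 0) (0, y.2) = β x.1 y.2 := rfl
  have e3 : E' (0, x.2) (y.1, 0) = -β y.1 x.2 := hskew _ _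
  have e4 : E' (0, x.2) (0, y.2) = δ x.2 y.2 := rfl
  rw [e1, e2, e3, e4, hαc, hβ0, hβ0, hδc, riemannForm_apply]
  simp only [Prod.fst_add, Prod.snd_add, add_zero, zero_add]
  ring

end Invariant

end WeilFamily

end Literature.AlgebraicGeometry.HodgeTheory
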